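import Summits.CriticalPhenomena.PercolationContinuityZ3.Theorems.PercNearOneGluingNoHeavyQuantLawDecFlowsDecomposition
import Literature.Analysis.Convex.LinearProgrammingDuality
import HarnessLib

/-!
# QUANT lane R8, T-DEC: STRONG DUALITY for the flow normal form of DEC — `LawDec.FlowAtT` (hence `LawDec.DECAtT`) holds as soon as every
# price system satisfies the weak-duality inequality (`LawDec.flowAtT_of_prices`, `LawDec.decAtT_iff_prices`)

builds on p205010 (kernel theorem, internal audit signed; external expert review pending)

Support file (`--supports stmt-CriticalPhenomena-4575`), QUANT lane seat prim-quant-census-2 (gen 54), rung R8 of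
`run/shared/lean/prim/quant/LADDER.md`.  Theorems with standard axioms, no sorries.  Continues typer g22's `…QuantLawDecFlows`
(`LawDec.FlowAtT`, `LawDec.usage`, weak duality `LawDec.dual_le_of_decAtT`) and `…QuantLawDecFlowsDecomposition` (`decAtT_iff_flowAtT`);
the only external input is Farkas' lemma in the form of Schrijver's Corollary 7.1f, `Literature.Analysis.Convex.LPDuality.farkas_nonneg_le`.

WHY.  Weak duality is how a NON-DEC statement is proved (census-2 g54's `not_sliceClosed` exhibits violating prices).  Every DUAL proof of a
POSITIVE closure statement (memo SL-STRUCTURE-G54 §2b/§4: "every certificate of the slice is dominated by one layer's certificate plus a mean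
tilt") needs the converse: if no price system is violated then the flow exists.  This file puts that converse in the kernel once.

* `LawDec.flowAtT_of_prices` — if for every `β ≥ 0` on the atoms and every `α` with `α l ≤ usage(l,h)·β h` on compatible pairs
  (`l ≤ j′`, `2l < T`, `h ≤ M`, `h ≥ j′+1 ∨ T < l + h`) one has `Σ_{l ≤ j′, 2l<T} α l·μ l ≤ Σ_{h ≤ M, ¬(h ≤ j′ ∧ 2h < T)} β h·μ h`, then
  `FlowAtT x T j′ M μ`.  Proof: the flow LP is `∃ f ≥ 0, A f ≤ b` for an explicit matrix (`flowMat`, `flowRhs`: two rows per low atom for the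
  exact shipping, one row per absorber for the load, one row per invalid pair forcing `f = 0`); `farkas_nonneg_le` turns its solvability into the
  price condition, whose multipliers ARE a price system.
* `LawDec.flowAtT_iff_prices`, `LawDec.decAtT_iff_prices` (`0 < x < 1`, `μ = 0` above `M`, mass `1`) — the equivalences.

[this work]; Farkas' lemma [cite: Schrijver1986, Cor 7.1f (p. 90)] via `Literature.Analysis.Convex.LinearProgrammingDuality`.  The gluing rows served
[cite: KozmaNitzan2024, Conjecture 3 (p. 15)]; product measure [cite: Grimmett1999, §1.3 p. 10].
-/

noncomputable section

namespace Summit.CriticalPhenomena.PercolationContinuityZ3.Theorems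

namespace Quant

open Finset Matrix

namespace LawDec

/-! ### The flow LP as a matrix system -/

/-- column index: a pair `(l, h)` with `l ≤ j′`, `h ≤ M` -/
abbrev FlowCol (j' M : ℕ) := Fin (j' + 1) × Fin (M + 1)

/-- row index: `(low ≤) ⊕ (low ≥)` then `(absorber load) ⊕ (invalid pair)` -/
abbrev FlowRow (j' M : ℕ) := (Fin (j' + 1) ⊕ Fin (j' + 1)) ⊕ (Fin (M + 1) ⊕ FlowCol j' M)

/-- a pair may carry flow: low source, compatible absorber. [this work] -/
def ValidPair (T : ℝ) (j' M : ℕ) (c : FlowCol j' M) : Prop :=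
  2 * ((c.1 : ℕ) : ℝ) < T ∧ (j' + 1 ≤ (c.2 : ℕ) ∨ T < ((c.1 : ℕ) : ℝ) + ((c.2 : ℕ) : ℝ))

/-- the constraint matrix of the flow LP. [this work] -/
def flowMat (x T : ℝ) (j' M : ℕ) : Matrix (FlowRow j' M) (FlowCol j' M) ℝ := by
  classical
  exact fun r c =>
    match r with
    | Sum.inl (Sum.inl l) => if c.1 = l then 1 else 0
    | Sum.inl (Sum.inr l) => if c.1 = l then -1 else 0
    | Sum.inr (Sum.inl h) => if c.2 = h then usage x T j' c.1 c.2 else 0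
    | Sum.inr (Sum.inr p) => if c = p ∧ ¬ ValidPair T j' M p then 1 else 0

/-- the right-hand side of the flow LP. [this work] -/
def flowRhs (T : ℝ) (j' M : ℕ) (μ : ℕ → ℝ) : FlowRow j' M → ℝ := by
  classical
  exact fun r =>
    match r with
    | Sum.inl (Sum.inl l) => if 2 * ((l : ℕ) : ℝ) < T then μ l else 0
    | Sum.inl (Sum.inr l) => if 2 * ((l : ℕ) : ℝ) < T then -μ l else 0
    | Sum.inr (Sum.inl h) => if j' + 1 ≤ (h : ℕ) ∨ T ≤ 2 * ((h : ℕ) : ℝ) then μ h else 0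
    | Sum.inr (Sum.inr _) => 0

/-! ### A solution of the matrix system is a flow -/

/-- unfolding `mulVec` of `flowMat` row by row. [this work] -/
theorem flowMat_mulVec (x T : ℝ) (j' M : ℕ) (f : FlowCol j' M → ℝ) (r : FlowRow j' M) :
    (flowMat x T j' M *ᵥ f) r = ∑ c : FlowCol j' M, flowMat x T j' M r c * f c := rfl

/-- **a nonnegative solution of `flowMat f ≤ flowRhs` is a `FlowAtT` datum.** [this work] -/
theorem flowAtT_of_matrix (x T : ℝ) (j' M : ℕ) (μ : ℕ → ℝ) (f : FlowCol j' M → ℝ) (hf0 : 0 ≤ f)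
    (hAf : flowMat x T j' M *ᵥ f ≤ flowRhs T j' M μ) : FlowAtT x T j' M μ := by
  classical
  -- the rows, unfolded
  have rowLe : ∀ l : Fin (j' + 1), ∑ h : Fin (M + 1), f (l, h) ≤ (if 2 * ((l : ℕ) : ℝ) < T then μ l else 0) := by
    intro l
    have := hAf (Sum.inl (Sum.inl l))
    rw [flowMat_mulVec] at this
    simp only [flowMat, flowRhs, ite_mul, one_mul, zero_mul] at this
    rw [Fintype.sum_prod_type] at this
    simpa [Finset.sum_ite_eq', Finset.sum_comm] using this
  have rowGe : ∀ l : Fin (j' + 1), (if 2 * ((l : ℕ) : ℝ) < T then μ l else 0) ≤ ∑ h : Fin (M + 1), f (l, h) := by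
    intro l
    have := hAf (Sum.inl (Sum.inr l))
    rw [flowMat_mulVec] at this
    simp only [flowMat, flowRhs, ite_mul, neg_mul, one_mul, zero_mul] at this
    rw [Fintype.sum_prod_type] at this
    have e : ∑ a : Fin (j' + 1), ∑ b : Fin (M + 1), (if a = l then -f (a, b) else 0) = -∑ b : Fin (M + 1), f (l, b) := by
      rw [Finset.sum_comm]
      simp only [Finset.sum_ite_eq', Finset.mem_univ, if_true, Finset.sum_neg_distrib]
    rw [e] at this
    split_ifs at this ⊢ with hl
    · linarith
    · linarith
  have rowCap : ∀ h : Fin (M + 1), (j' + 1 ≤ (h : ℕ) ∨ T ≤ 2 * ((h : ℕ) : ℝ)) →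
      ∑ l : Fin (j' + 1), usage x T j' l h * f (l, h) ≤ μ h := by
    intro h hh
    have := hAf (Sum.inr (Sum.inl h))
    rw [flowMat_mulVec] at this
    simp only [flowMat, flowRhs, ite_mul, zero_mul, if_pos hh] at this
    rw [Fintype.sum_prod_type] at this
    simpa [Finset.sum_ite_eq'] using this
  have rowInv : ∀ p : FlowCol j' M, ¬ ValidPair T j' M p → f p ≤ 0 := by
    intro p hp
    have := hAf (Sum.inr (Sum.inr p))
    rw [flowMat_mulVec] at this
    simp only [flowMat, flowRhs, ite_mul, one_mul, zero_mul] at this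
    have e : ∑ c : FlowCol j' M, (if c = p ∧ ¬ ValidPair T j' M p then f c else 0) = f p := by
      rw [Finset.sum_eq_single p]
      · rw [if_pos ⟨rfl, hp⟩]
      · intro c _ hc; rw [if_neg (fun h => hc h.1)]
      · intro hnp; exact absurd (Finset.mem_univ p) hnp
    rw [e] at this
    exact this
  have fzero : ∀ p : FlowCol j' M, ¬ ValidPair T j' M p → f p = 0 := fun p hp => le_antisymm (rowInv p hp) (hf0 p)
  -- the flow on `ℕ × ℕ`
  refine ⟨fun l h => if hl : l < j' + 1 then (if hh : h < M + 1 then f (⟨l, hl⟩, ⟨h, hh⟩) else 0) else 0, ?_, ?_, ?_, ?_⟩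
  · intro l h
    dsimp only
    split_ifs
    · exact hf0 _
    · exact le_rfl
    · exact le_rfl
  · intro l h hpos
    dsimp only at hpos
    by_cases hl : l < j' + 1
    · rw [dif_pos hl] at hpos
      by_cases hh : h < M + 1
      · rw [dif_pos hh] at hpos
        have hv : ValidPair T j' M (⟨l, hl⟩, ⟨h, hh⟩) := by
          by_contra hnv
          rw [fzero _ hnv] at hpos
          exact lt_irrefl _ hpos
        exact ⟨by omega, hv.1, by omega, hv.2⟩
      · rw [dif_neg hh] at hpos; exact absurd hpos (lt_irrefl _)
    · rw [dif_neg hl] at hpos; exact absurd hpos (lt_irrefl _)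
  · intro l hlj hlow
    have hl : l < j' + 1 := Nat.lt_succ_of_le hlj
    rw [← Fin.sum_univ_eq_sum_range (fun h => if hl' : l < j' + 1 then
        (if hh : h < M + 1 then f (⟨l, hl'⟩, ⟨h, hh⟩) else 0) else 0) (M + 1)]
    have e : ∀ h : Fin (M + 1), (if hl' : l < j' + 1 then (if hh : (h : ℕ) < M + 1 then f (⟨l, hl'⟩, ⟨h, hh⟩) else 0) else 0)
        = f (⟨l, hl⟩, h) := by
      intro h; rw [dif_pos hl, dif_pos h.2]
    simp only [e]
    have h1 := rowLe ⟨l, hl⟩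
    have h2 := rowGe ⟨l, hl⟩
    simp only [if_pos hlow] at h1 h2
    exact le_antisymm h1 h2
  · intro h hhM hh
    have hh' : h < M + 1 := Nat.lt_succ_of_le hhM
    rw [← Fin.sum_univ_eq_sum_range (fun l => usage x T j' l h * (if hl : l < j' + 1 then
        (if hh2 : h < M + 1 then f (⟨l, hl⟩, ⟨h, hh2⟩) else 0) else 0)) (j' + 1)]
    have e : ∀ l : Fin (j' + 1), usage x T j' l h * (if hl : (l : ℕ) < j' + 1 then
        (if hh2 : h < M + 1 then f (⟨l, hl⟩, ⟨h, hh2⟩) else 0) else 0) = usage x T j' l h * f (l, ⟨h, hh'⟩) := by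
      intro l; rw [dif_pos l.2, dif_pos hh']
    simp only [e]
    exact rowCap ⟨h, hh'⟩ hh

/-! ### Strong duality -/

/-- **STRONG DUALITY FOR THE FLOW FORM OF DEC.**  If every price system — `β ≥ 0` on the atoms, `α l ≤ usage(l,h)·β h` for every low
`l ≤ j′` (`2l < T`) and compatible absorber `h ≤ M` — satisfies `Σ_{low} α l·μ l ≤ Σ_{non-low h ≤ M} β h·μ h`, then `FlowAtT x T j′ M μ`.
(Farkas' lemma, Schrijver Cor. 7.1f, applied to `flowMat`/`flowRhs`.) [this work] -/
theorem flowAtT_of_prices (x T : ℝ) (j' M : ℕ) (μ : ℕ → ℝ)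
    (hprices : ∀ α β : ℕ → ℝ, (∀ h, 0 ≤ β h) →
      (∀ l h, l ≤ j' → 2 * (l : ℝ) < T → h ≤ M → (j' + 1 ≤ h ∨ T < (l : ℝ) + h) → α l ≤ usage x T j' l h * β h) →
      ∑ l ∈ Finset.range (j' + 1), (if 2 * (l : ℝ) < T then α l * μ l else 0)
        ≤ ∑ h ∈ Finset.range (M + 1), (if h ≤ j' ∧ 2 * (h : ℝ) < T then 0 else β h * μ h)) :
    FlowAtT x T j' M μ := by
  classical
  obtain ⟨f, hf0, hAf⟩ := (Literature.Analysis.Convex.LPDuality.farkas_nonneg_le (flowMat x T j' M) (flowRhs T j' M μ)).2 (by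
    intro y hy hyA
    -- the multipliers are a price system
    set α : ℕ → ℝ := fun l => if hl : l < j' + 1 then y (Sum.inl (Sum.inr ⟨l, hl⟩)) - y (Sum.inl (Sum.inl ⟨l, hl⟩)) else 0 with hα
    set β : ℕ → ℝ := fun h => if hh : h < M + 1 then y (Sum.inr (Sum.inl ⟨h, hh⟩)) else 0 with hβ
    have hβ0 : ∀ h, 0 ≤ β h := by
      intro h; simp only [hβ]; split_ifs
      · exact hy _
      · exact le_rfl
    have hαβ : ∀ l h, l ≤ j' → 2 * (l : ℝ) < T → h ≤ M → (j' + 1 ≤ h ∨ T < (l : ℝ) + h) →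
        α l ≤ usage x T j' l h * β h := by
      intro l h hlj hlow hhM hcomp
      have hl : l < j' + 1 := Nat.lt_succ_of_le hlj
      have hh : h < M + 1 := Nat.lt_succ_of_le hhM
      have hv : ValidPair T j' M ((⟨l, hl⟩, ⟨h, hh⟩) : FlowCol j' M) := ⟨hlow, hcomp⟩
      have key := hyA ((⟨l, hl⟩, ⟨h, hh⟩) : FlowCol j' M)
      -- unfold `vecMul` at this column
      have e : (y ᵥ* flowMat x T j' M) (⟨l, hl⟩, ⟨h, hh⟩) =
          y (Sum.inl (Sum.inl ⟨l, hl⟩)) - y (Sum.inl (Sum.inr ⟨l, hl⟩)) + y (Sum.inr (Sum.inl ⟨h, hh⟩)) * usage x T j' l h := by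
        rw [Matrix.vecMul, dotProduct, Fintype.sum_sum_type, Fintype.sum_sum_type, Fintype.sum_sum_type]
        simp only [flowMat, mul_ite, mul_one, mul_zero, mul_neg]
        rw [Finset.sum_ite_eq Finset.univ (⟨l, hl⟩ : Fin (j' + 1)), Finset.sum_ite_eq Finset.univ (⟨l, hl⟩ : Fin (j' + 1)),
          Finset.sum_ite_eq Finset.univ (⟨h, hh⟩ : Fin (M + 1))]
        simp only [Finset.mem_univ, if_true]
        have ez : ∑ p : FlowCol j' M, (if ((⟨l, hl⟩, ⟨h, hh⟩) : FlowCol j' M) = p ∧ ¬ ValidPair T j' M p then y (Sum.inr (Sum.inr p)) else 0) = 0 :=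
          Finset.sum_eq_zero fun p _ => by
            rw [if_neg]
            rintro ⟨hp, hnv⟩
            exact hnv (hp ▸ hv)
        rw [ez]
        ring
      rw [e] at key
      simp only [Pi.zero_apply] at key
      simp only [hα, hβ, dif_pos hl, dif_pos hh]
      linarith
    have main := hprices α β hβ0 hαβ
    -- `y ⬝ᵥ flowRhs = -Σ α μ(low) + Σ β μ(abs)`
    have e1 : y ⬝ᵥ flowRhs T j' M μ =
        ∑ l : Fin (j' + 1), (y (Sum.inl (Sum.inl l)) - y (Sum.inl (Sum.inr l))) * (if 2 * ((l : ℕ) : ℝ) < T then μ l else 0)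
        + ∑ h : Fin (M + 1), y (Sum.inr (Sum.inl h)) * (if j' + 1 ≤ (h : ℕ) ∨ T ≤ 2 * ((h : ℕ) : ℝ) then μ h else 0) := by
      rw [dotProduct, Fintype.sum_sum_type, Fintype.sum_sum_type, Fintype.sum_sum_type]
      simp only [flowRhs, mul_zero, Finset.sum_const_zero, add_zero]
      rw [← Finset.sum_add_distrib]
      congr 1
      refine Finset.sum_congr rfl fun l _ => ?_
      split_ifs <;> ring
    rw [e1]
    have e2 : ∑ l ∈ Finset.range (j' + 1), (if 2 * (l : ℝ) < T then α l * μ l else 0)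
        = ∑ l : Fin (j' + 1), (y (Sum.inl (Sum.inr l)) - y (Sum.inl (Sum.inl l))) * (if 2 * ((l : ℕ) : ℝ) < T then μ l else 0) := by
      rw [← Fin.sum_univ_eq_sum_range]
      refine Finset.sum_congr rfl fun l _ => ?_
      simp only [hα, dif_pos l.2]
      split_ifs <;> ring
    have e3 : ∑ h ∈ Finset.range (M + 1), (if h ≤ j' ∧ 2 * (h : ℝ) < T then 0 else β h * μ h)
        = ∑ h : Fin (M + 1), y (Sum.inr (Sum.inl h)) * (if j' + 1 ≤ (h : ℕ) ∨ T ≤ 2 * ((h : ℕ) : ℝ) then μ h else 0) := by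
      rw [← Fin.sum_univ_eq_sum_range]
      refine Finset.sum_congr rfl fun h _ => ?_
      simp only [hβ, dif_pos h.2]
      by_cases hc : (h : ℕ) ≤ j' ∧ 2 * ((h : ℕ) : ℝ) < T
      · have hnc : ¬ (j' + 1 ≤ (h : ℕ) ∨ T ≤ 2 * ((h : ℕ) : ℝ)) := by
          rintro (h1 | h1)
          · exact absurd hc.1 (by omega)
          · exact absurd hc.2 (not_lt.2 h1)
        rw [if_pos hc, if_neg hnc]
        ring
      · have hc' : j' + 1 ≤ (h : ℕ) ∨ T ≤ 2 * ((h : ℕ) : ℝ) := by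
          by_cases h1 : j' + 1 ≤ (h : ℕ)
          · exact Or.inl h1
          · exact Or.inr (not_lt.1 fun h2 => hc ⟨by omega, h2⟩)
        rw [if_neg hc, if_pos hc']
    rw [e2, e3] at main
    have e4 : ∑ l : Fin (j' + 1), (y (Sum.inl (Sum.inl l)) - y (Sum.inl (Sum.inr l))) * (if 2 * ((l : ℕ) : ℝ) < T then μ l else 0)
        = -∑ l : Fin (j' + 1), (y (Sum.inl (Sum.inr l)) - y (Sum.inl (Sum.inl l))) * (if 2 * ((l : ℕ) : ℝ) < T then μ l else 0) := by
      rw [← Finset.sum_neg_distrib]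
      refine Finset.sum_congr rfl fun l _ => ?_
      ring
    rw [e4]
    linarith)
  exact flowAtT_of_matrix x T j' M μ f hf0 hAf

/-- **`FlowAtT` ⟺ every price system satisfies the weak-duality inequality.** [this work] -/
theorem flowAtT_iff_prices (x T : ℝ) (j' M : ℕ) (μ : ℕ → ℝ) (hx0 : 0 < x) (hx1 : x < 1)
    (hμM : ∀ h, M < h → μ h = 0) (hμ1 : ∑ h ∈ Finset.range (M + 1), μ h = 1) :
    FlowAtT x T j' M μ ↔
      ∀ α β : ℕ → ℝ, (∀ h, 0 ≤ β h) →
        (∀ l h, l ≤ j' → 2 * (l : ℝ) < T → h ≤ M → (j' + 1 ≤ h ∨ T < (l : ℝ) + h) → α l ≤ usage x T j' l h * β h) →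
        ∑ l ∈ Finset.range (j' + 1), (if 2 * (l : ℝ) < T then α l * μ l else 0)
          ≤ ∑ h ∈ Finset.range (M + 1), (if h ≤ j' ∧ 2 * (h : ℝ) < T then 0 else β h * μ h) := by
  constructor
  · intro hf α β hβ hαβ
    exact dual_le_of_decAtT x T j' M μ hx0 hx1 ((decAtT_iff_flowAtT x T j' M μ hx0 hx1 hμM hμ1).2 hf) α β hβ hαβ
  · exact flowAtT_of_prices x T j' M μ

/-- **`DECAtT` ⟺ every price system satisfies the weak-duality inequality** (`0 < x < 1`, law facts). [this work] -/
theorem decAtT_iff_prices (x T : ℝ) (j' M : ℕ) (μ : ℕ → ℝ) (hx0 : 0 < x) (hx1 : x < 1)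
    (hμM : ∀ h, M < h → μ h = 0) (hμ1 : ∑ h ∈ Finset.range (M + 1), μ h = 1) :
    DECAtT x T j' M μ ↔
      ∀ α β : ℕ → ℝ, (∀ h, 0 ≤ β h) →
        (∀ l h, l ≤ j' → 2 * (l : ℝ) < T → h ≤ M → (j' + 1 ≤ h ∨ T < (l : ℝ) + h) → α l ≤ usage x T j' l h * β h) →
        ∑ l ∈ Finset.range (j' + 1), (if 2 * (l : ℝ) < T then α l * μ l else 0)
          ≤ ∑ h ∈ Finset.range (M + 1), (if h ≤ j' ∧ 2 * (h : ℝ) < T then 0 else β h * μ h) := by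
  rw [decAtT_iff_flowAtT x T j' M μ hx0 hx1 hμM hμ1]
  exact flowAtT_iff_prices x T j' M μ hx0 hx1 hμM hμ1

end LawDec

end Quant

end Summit.CriticalPhenomena.PercolationContinuityZ3.Theorems
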